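import Summits.Schanuel.Schanuel.Theorems.ZilberEacRelationGeneral
import HarnessLib

/-!
# THEOREM N — elimination along (log, linear, linear) growth with infinitely many limit ratios

Zilber's Exponential-Algebraic Closedness, case ladder (host summit Schanuel, cell `pub-schanuel`,
seat 2, gen 13).  The density engines of gens 8–12 (THEOREMS G, H, I, J, J′, K, K′, L, L″, M, M₂)
all read families of exponential points indexed by LATTICE RAYS `2πi m q`.  The critical-size
regime of O54 (a) (`x₂ = r₀x₀ + (1 - r₀)x₁`, `yⱼ = xⱼ + y₂`, `r₀ ∉ ℚ`) is solved in gen 13 along a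
different kind of family: lattice points `(n₁ + d, n₁)` near the IRRATIONAL real line `n₁ = -r₀ d`,
with the near-resonance defect `ε = r₀ d + n₁` acting as a continuous parameter.  Along such a
family three coordinates grow like `(log d, d, d)`:  `x₂ ~ log d`, `x₀ ~ 2πi(1 - r₀) d`,
`y₂ ~ T(ε) d`, and the ratio `y₂ / d → T*` takes INFINITELY MANY limit values `T*` as the
near-resonance parameter varies.

**THEOREM N (`mvPolynomial_eq_zero_of_logLinLin`).**  Let `G ∈ ℂ[U, W, T]`, `W* ≠ 0`, and `𝒯 ⊆ ℂ`
infinite.  Suppose that for every `T* ∈ 𝒯` there are sequences `u_k, w_k, t_k` and real scales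
`L_k → ∞`, `D_k → ∞` with `L_k^a / D_k → 0` for every `a`, `u_k / L_k → 1`, `w_k / D_k → W*`,
`t_k / D_k → T*`, and `G(u_k, w_k, t_k) = 0` for all large `k`.  Then `G = 0`.
Proof: let `D = max (deg_W + deg_T)` over the support, `a*` the largest `U`-degree on that top
class; dividing `G(u_k, w_k, t_k)` by `L_k^{a*} D_k^{D}` every monomial off the pivot class tends to
`0` and the pivot class tends to `P(T*)`, `P(T) = Σ_{a = a*, b + c = D} g_{abc} W*^b T^c ≠ 0`
(`c ↦ (a*, D - c, c)` is injective on the pivot class).  So `P` vanishes on the infinite set `𝒯`: impossible.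

Density form **`unprojectedDense_of_logLinLin`** (via THEOREM H⁽ᵏ⁾,
`unprojectedDense_of_no_relation`): three coordinates of the exponential points of an irreducible
`S` with `dim S ≤ 3` realising such families for infinitely many `T*` ⟹ `I(S ∩ Γ_exp) = I(S)`.

HONEST FRAMING: an elimination lemma; the cell `EC(3,2)` is OPEN; NOT Schanuel's conjecture;
EAC ⇏ SC.
-/

noncomputable section

open Complex MvPolynomial Filter Topology
open Literature.NumberTheory.Transcendental Literature.ModelTheory.Zilber
  Literature.ModelTheory.ExponentialFields

set_option linter.dupNamespace false

namespace Summit.Schanuel.Schanuel.Theorems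

/-! ## Part A. Scalar limits of the normalising factors -/

section Scalars

/-- Off the top class in `(W, T)`-degree: `L^a / (L^{a*} D^e) → 0` for `e ≥ 1` when `L → ∞`,
`D → ∞` and `L^a / D → 0`. [folklore] -/
theorem tendsto_scale_of_lt {L D : ℕ → ℝ} (hL : Tendsto L atTop atTop) (hD : Tendsto D atTop atTop)
    {a : ℕ} (haD : Tendsto (fun k => L k ^ a / D k) atTop (𝓝 0)) (astar : ℕ) {e : ℕ} (he : 1 ≤ e) :
    Tendsto (fun k => L k ^ a / (L k ^ astar * D k ^ e)) atTop (𝓝 0) := by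
  have hL1 : ∀ᶠ k in atTop, 1 ≤ L k := hL.eventually_ge_atTop 1
  have hD1 : ∀ᶠ k in atTop, 1 ≤ D k := hD.eventually_ge_atTop 1
  refine squeeze_zero_norm' ?_ haD
  filter_upwards [hL1, hD1] with k hLk hDk
  have hLpos : 0 < L k := by linarith
  have hDpos : 0 < D k := by linarith
  rw [Real.norm_eq_abs, abs_of_nonneg (by positivity)]
  rw [div_le_div_iff₀ (by positivity) hDpos]
  have h1 : (1 : ℝ) ≤ L k ^ astar := one_le_pow₀ hLk
  have h2 : D k ≤ D k ^ e := by
    calc D k = D k ^ 1 := (pow_one _).symm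
      _ ≤ D k ^ e := pow_le_pow_right₀ hDk he
  calc L k ^ a * D k = L k ^ a * 1 * D k := by ring
    _ ≤ L k ^ a * L k ^ astar * D k ^ e := by gcongr
    _ = L k ^ a * (L k ^ astar * D k ^ e) := by ring

/-- On the top `(W, T)`-class but below the pivot `U`-degree: `L^a / L^{a*} → 0` for `a < a*`.
[folklore] -/
theorem tendsto_scale_of_lt_pivot {L : ℕ → ℝ} (hL : Tendsto L atTop atTop) {a astar : ℕ}
    (ha : a < astar) : Tendsto (fun k => L k ^ a / L k ^ astar) atTop (𝓝 0) := by
  have hL1 : ∀ᶠ k in atTop, 1 ≤ L k := hL.eventually_ge_atTop 1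
  have hinv : Tendsto (fun k => (L k ^ (astar - a))⁻¹) atTop (𝓝 0) :=
    (tendsto_pow_atTop (Nat.sub_ne_zero_of_lt ha)).inv_tendsto_atTop.comp hL |>.congr fun _ => rfl
  refine hinv.congr' ?_
  filter_upwards [hL1] with k hLk
  have hLpos : 0 < L k := by linarith
  rw [eq_div_iff (pow_ne_zero _ hLpos.ne'), ← pow_sub_mul_pow (L k) ha.le,
    inv_mul_cancel_left₀ (pow_ne_zero _ hLpos.ne')]

end Scalars

/-! ## Part B. THEOREM N -/

section Engine

/-- A monomial of `ℂ[U, W, T]` evaluated: `∏ᵢ xᵢ^{mᵢ} = x₀^{m₀} x₁^{m₁} x₂^{m₂}`. [folklore] -/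
theorem eval_eq_sum_fin_three (G : MvPolynomial (Fin 3) ℂ) (x : Fin 3 → ℂ) :
    eval x G = ∑ m ∈ G.support, coeff m G * (x 0 ^ m 0 * x 1 ^ m 1 * x 2 ^ m 2) := by
  rw [MvPolynomial.eval_eq']
  refine Finset.sum_congr rfl fun m _ => ?_
  rw [Fin.prod_univ_three]

/-- **THEOREM N (elimination along `(log, lin, lin)` growth with infinitely many limit ratios).**
See the module docstring. (new) -/
theorem mvPolynomial_eq_zero_of_logLinLin (G : MvPolynomial (Fin 3) ℂ) {Wst : ℂ} (hW : Wst ≠ 0)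
    {𝒯 : Set ℂ} (h𝒯 : 𝒯.Infinite)
    (h : ∀ Tst ∈ 𝒯, ∃ (x : ℕ → Fin 3 → ℂ) (L D : ℕ → ℝ),
      Tendsto L atTop atTop ∧ Tendsto D atTop atTop ∧
      (∀ a : ℕ, Tendsto (fun k => L k ^ a / D k) atTop (𝓝 0)) ∧
      Tendsto (fun k => x k 0 / L k) atTop (𝓝 1) ∧
      Tendsto (fun k => x k 1 / D k) atTop (𝓝 Wst) ∧
      Tendsto (fun k => x k 2 / D k) atTop (𝓝 Tst) ∧
      ∀ᶠ k in atTop, eval (x k) G = 0) :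
    G = 0 := by
  classical
  by_contra hG0
  have hne : G.support.Nonempty := MvPolynomial.support_nonempty.2 hG0
  -- the top `(W,T)`-degree `Dm` and the pivot `U`-degree `astar`
  obtain ⟨m₁, hm₁, hmax₁⟩ := G.support.exists_max_image (fun m : Fin 3 →₀ ℕ => m 1 + m 2) hne
  set Dm : ℕ := m₁ 1 + m₁ 2 with hDm
  set S₁ : Finset (Fin 3 →₀ ℕ) := G.support.filter fun m => m 1 + m 2 = Dm with hS₁
  have hm₁S₁ : m₁ ∈ S₁ := Finset.mem_filter.2 ⟨hm₁, rfl⟩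
  obtain ⟨m₂, hm₂, hmax₂⟩ := S₁.exists_max_image (fun m : Fin 3 →₀ ℕ => m 0) ⟨m₁, hm₁S₁⟩
  set astar : ℕ := m₂ 0 with hastar
  set S₂ : Finset (Fin 3 →₀ ℕ) := S₁.filter fun m => m 0 = astar with hS₂
  have hm₂S₂ : m₂ ∈ S₂ := Finset.mem_filter.2 ⟨hm₂, rfl⟩
  have hS₂sub : ∀ m ∈ S₂, m ∈ G.support ∧ m 1 + m 2 = Dm ∧ m 0 = astar := by
    intro m hm
    obtain ⟨hm', h0⟩ := Finset.mem_filter.1 hm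
    obtain ⟨hm'', h12⟩ := Finset.mem_filter.1 hm'
    exact ⟨hm'', h12, h0⟩
  -- the polynomial `P(T) = Σ_{pivot class} g_m W*^{m 1} T^{m 2}`
  set P : Polynomial ℂ := ∑ m ∈ S₂, Polynomial.C (coeff m G * Wst ^ m 1) * Polynomial.X ^ m 2
    with hP
  have hP0 : P ≠ 0 := by
    intro hP0
    have hc : P.coeff (m₂ 2) = coeff m₂ G * Wst ^ m₂ 1 := by
      rw [hP, Polynomial.finsetSum_coeff]
      rw [Finset.sum_eq_single m₂]
      · rw [Polynomial.coeff_C_mul, Polynomial.coeff_X_pow, if_pos rfl, mul_one]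
      · intro m hm hne'
        rw [Polynomial.coeff_C_mul, Polynomial.coeff_X_pow, if_neg, mul_zero]
        intro h22
        obtain ⟨-, h12, h0⟩ := hS₂sub m hm
        obtain ⟨-, h12', h0'⟩ := hS₂sub m₂ hm₂S₂
        apply hne'
        ext i
        fin_cases i
        · show m 0 = m₂ 0
          exact h0.trans h0'.symm
        · show m 1 = m₂ 1
          omega
        · show m 2 = m₂ 2
          exact h22.symm
      · intro h; exact absurd hm₂S₂ h
    rw [hP0, Polynomial.coeff_zero] at hc
    exact mul_ne_zero (mem_support_iff.1 (hS₂sub m₂ hm₂S₂).1) (pow_ne_zero _ hW) hc.symm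
  -- every `T* ∈ 𝒯` is a root of `P`
  have hroot : ∀ Tst ∈ 𝒯, P.IsRoot Tst := by
    intro Tst hTst
    obtain ⟨x, L, D, hL, hD, hLD, hu, hw, ht, hzero⟩ := h Tst hTst
    have hL0 : ∀ᶠ k in atTop, L k ≠ 0 := (hL.eventually_gt_atTop 0).mono fun k hk => hk.ne'
    have hD0 : ∀ᶠ k in atTop, D k ≠ 0 := (hD.eventually_gt_atTop 0).mono fun k hk => hk.ne'
    -- the normalising factor of a monomial and its limit
    set scal : (Fin 3 →₀ ℕ) → ℕ → ℝ := fun m k =>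
      L k ^ m 0 * D k ^ (m 1 + m 2) / (L k ^ astar * D k ^ Dm) with hscal
    set slim : (Fin 3 →₀ ℕ) → ℝ := fun m => if m ∈ S₂ then 1 else 0 with hslim
    have hscal_lim : ∀ m ∈ G.support, Tendsto (scal m) atTop (𝓝 (slim m)) := by
      intro m hm
      by_cases hmS₂ : m ∈ S₂
      · obtain ⟨-, h12, h0⟩ := hS₂sub m hmS₂
        have e1 : slim m = 1 := by simp only [hslim, if_pos hmS₂]
        rw [e1]
        refine tendsto_const_nhds.congr' ?_
        filter_upwards [hL0, hD0] with k hLk hDk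
        simp only [hscal]
        rw [h12, h0, div_self (mul_ne_zero (pow_ne_zero _ hLk) (pow_ne_zero _ hDk))]
      · have e0 : slim m = 0 := by simp only [hslim, if_neg hmS₂]
        rw [e0]
        have hle : m 1 + m 2 ≤ Dm := hmax₁ m hm
        rcases hle.lt_or_eq with hlt | heq
        · -- below the top `(W,T)`-class
          have := tendsto_scale_of_lt hL hD (hLD (m 0)) astar (e := Dm - (m 1 + m 2)) (by omega)
          refine this.congr' ?_
          filter_upwards [hL0, hD0] with k hLk hDk
          simp only [hscal]
          have hsplit : D k ^ Dm = D k ^ (Dm - (m 1 + m 2)) * D k ^ (m 1 + m 2) := by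
            rw [← pow_add]; congr 1; omega
          rw [hsplit]
          field_simp
        · -- on the top class but below the pivot
          have hmS₁ : m ∈ S₁ := Finset.mem_filter.2 ⟨hm, heq⟩
          have h0le : m 0 ≤ astar := hmax₂ m hmS₁
          have h0lt : m 0 < astar := lt_of_le_of_ne h0le fun h0 =>
            hmS₂ (Finset.mem_filter.2 ⟨hmS₁, h0⟩)
          refine (tendsto_scale_of_lt_pivot hL h0lt).congr' ?_
          filter_upwards [hD0] with k hDk
          simp only [hscal]
          rw [heq, mul_div_mul_right _ _ (pow_ne_zero _ hDk)]
    -- the normalised terms and their limits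
    set term : (Fin 3 →₀ ℕ) → ℕ → ℂ := fun m k =>
      coeff m G * ((x k 0 / L k) ^ m 0 * (x k 1 / D k) ^ m 1 * (x k 2 / D k) ^ m 2) *
        (scal m k : ℂ) with hterm
    have hterm_lim : ∀ m ∈ G.support, Tendsto (term m) atTop
        (𝓝 (coeff m G * ((1 : ℂ) ^ m 0 * Wst ^ m 1 * Tst ^ m 2) * (slim m : ℂ))) := by
      intro m hm
      exact (tendsto_const_nhds.mul (((hu.pow _).mul (hw.pow _)).mul (ht.pow _))).mul
        ((continuous_ofReal.tendsto _).comp (hscal_lim m hm))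
    have hsum_lim : Tendsto (fun k => ∑ m ∈ G.support, term m k) atTop
        (𝓝 (∑ m ∈ G.support,
          coeff m G * ((1 : ℂ) ^ m 0 * Wst ^ m 1 * Tst ^ m 2) * (slim m : ℂ))) :=
      tendsto_finsetSum _ fun m hm => hterm_lim m hm
    -- the sum of the normalised terms is `G(x_k) / (L_k^{a*} D_k^{Dm})`, eventually `0`
    have hsum_eq : ∀ᶠ k in atTop, ∑ m ∈ G.support, term m k =
        eval (x k) G / ((L k : ℂ) ^ astar * (D k : ℂ) ^ Dm) := by
      filter_upwards [hL0, hD0] with k hLk hDk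
      rw [eval_eq_sum_fin_three, Finset.sum_div]
      refine Finset.sum_congr rfl fun m _ => ?_
      have hLc : (L k : ℂ) ≠ 0 := ofReal_ne_zero.2 hLk
      have hDc : (D k : ℂ) ≠ 0 := ofReal_ne_zero.2 hDk
      simp only [hterm, hscal, div_pow]
      push_cast
      field_simp
      ring
    have hlim0 : Tendsto (fun k => ∑ m ∈ G.support, term m k) atTop (𝓝 0) := by
      refine tendsto_const_nhds.congr' ?_
      filter_upwards [hsum_eq, hzero] with k hk hz
      rw [hk, hz, zero_div]
    have hval : ∑ m ∈ G.support,
        coeff m G * ((1 : ℂ) ^ m 0 * Wst ^ m 1 * Tst ^ m 2) * (slim m : ℂ) = P.eval Tst := by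
      have e1 : ∀ m ∈ G.support,
          coeff m G * ((1 : ℂ) ^ m 0 * Wst ^ m 1 * Tst ^ m 2) * (slim m : ℂ) =
            if m ∈ S₂ then coeff m G * Wst ^ m 1 * Tst ^ m 2 else 0 := by
        intro m _
        simp only [hslim]
        split_ifs
        · push_cast; ring
        · push_cast; ring
      rw [Finset.sum_congr rfl e1, Finset.sum_ite_mem,
        Finset.inter_eq_right.2 (fun m hm => (hS₂sub m hm).1), hP, Polynomial.eval_finsetSum]
      refine Finset.sum_congr rfl fun m _ => ?_
      simp only [Polynomial.eval_mul, Polynomial.eval_C, Polynomial.eval_pow, Polynomial.eval_X]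
    have huniq := tendsto_nhds_unique hsum_lim hlim0
    rw [hval] at huniq
    exact huniq
  exact hP0 (Polynomial.eq_zero_of_infinite_isRoot P (h𝒯.mono hroot))

end Engine

/-! ## Part C. Density form -/

section Density

variable {n : ℕ}

/-- **Density form of THEOREM N.**  `S ⊆ ℂⁿ × ℂⁿ` irreducible closed with `dim S ≤ 3`, three
coordinates `c₀, c₁, c₂`, `W* ≠ 0`, `𝒯 ⊆ ℂ` infinite; if for every `T* ∈ 𝒯` there are exponential
points `p_k ∈ S ∩ Γ_exp` (for all large `k`) and real scales `L_k → ∞`, `D_k → ∞` with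
`L_k^a / D_k → 0` (all `a`), `p_k(c₀)/L_k → 1`, `p_k(c₁)/D_k → W*`, `p_k(c₂)/D_k → T*`, then the
exponential points of `S` are Zariski dense: `I(S ∩ Γ_exp) = I(S)`. (new) -/
theorem unprojectedDense_of_logLinLin {S : Set (Fin n ⊕ Fin n → ℂ)}
    (hS : IsIrreducibleClosed ℂ S) (hdim : zariskiDim ℂ S ≤ ((2 + 1 : ℕ) : WithBot ℕ∞))
    (c : Fin 3 → Fin n ⊕ Fin n) {Wst : ℂ} (hW : Wst ≠ 0) {𝒯 : Set ℂ} (h𝒯 : 𝒯.Infinite)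
    (h : ∀ Tst ∈ 𝒯, ∃ (p : ℕ → Fin n ⊕ Fin n → ℂ) (L D : ℕ → ℝ),
      (∀ᶠ k in atTop, p k ∈ S ∩ expGraph ℂ n) ∧ Tendsto L atTop atTop ∧ Tendsto D atTop atTop ∧
      (∀ a : ℕ, Tendsto (fun k => L k ^ a / D k) atTop (𝓝 0)) ∧
      Tendsto (fun k => p k (c 0) / L k) atTop (𝓝 1) ∧
      Tendsto (fun k => p k (c 1) / D k) atTop (𝓝 Wst) ∧
      Tendsto (fun k => p k (c 2) / D k) atTop (𝓝 Tst)) :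
    UnprojectedDense S := by
  refine unprojectedDense_of_no_relation hS hdim c fun H hH => ?_
  by_contra hno
  push Not at hno
  apply hH
  refine mvPolynomial_eq_zero_of_logLinLin H hW h𝒯 fun Tst hTst => ?_
  obtain ⟨p, L, D, hp, hL, hD, hLD, hu, hw, ht⟩ := h Tst hTst
  exact ⟨fun k i => p k (c i), L, D, hL, hD, hLD, hu, hw, ht, hp.mono fun k hk => hno _ hk⟩

end Density

end Summit.Schanuel.Schanuel.Theorems

end
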